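import Literature.NumberTheory.EllipticCurves.GaussianLatticeThirdValues
import Literature.NumberTheory.EllipticCurves.GaussianLatticeFifthDivision
import HarnessLib

/-!
# The quartic-character-twisted `3`-torsion sums of `E₁*` on the Gaussian lattice (closed forms)

Summit `BirchSwinnertonDyer`, crux `InertBadAtThree` (stmt-BirchSwinnertonDyer-19225; K8 `InertBadSignedBranches` r4 / BED
`BiquadraticEisensteinDescent` r5), line of record `Lines/rubin_e1_inert_three.lean` (lead `bsd-line-ibd-p1`; registered stub
`stub_neronIntegralThreeQuartic` (v4) / `stub_plainOddNeronIntegralThreeQuartic` (v5) = `3`-integrality in Néron units of the twisted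
values `L(E_D, χ, 1)` of the quartic twists `y² = x³ − Dx`, `3 ∣ D`). This helper file delivers pieces **P4.0, P4.1, P4.2 (+ the
quarter-point rung P4.3/P4.4 in closed algebraic form, and the fourth powers of the constants)** of the stub plan
`Cruxes/InertBadAtThree/STUB-PLAN-neronIntegralThreeQuartic-bsd-idea-18-g8.md` (ideator bsd-idea-18 g8), width seat bsd-wall-cm-bed-w1 g7.

Setting (tree, `Literature.NumberTheory.EllipticCurves.GaussianLattice*`): `Λ = ℤi + ℤ`, `ϖ₀ = Γ(1/4)²/(2√(2π))`, `e₁ = ϖ₀²`,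
`g₂ = 4ϖ₀⁴`, `g₃ = 0`, `E₁*(z) = ζ(z) − π z̄ = kroneckerE₁ z`, `P₁ = ℘(1/3)`, `P₂ = ℘((1+i)/3)`,
`D(w) = 3℘(w)⁴ − 6ϖ₀⁴℘(w)² − ϖ₀⁸ = 3(℘(w)² − P₁²)(℘(w)² − P₂²)`. The tree evaluates the sum of `E₁*(w + v)` over the eight non-zero
`3`-division points `v` weighted by the QUADRATIC character `κ` of `ℤ[i]/3 ≅ 𝔽₉` (`GaussianLattice.kroneckerE₁_twisted_three_torsion_sum`:
`8√3 ϖ₀⁴ ℘℘'/D`). Here the same is done for the two QUARTIC characters of `𝔽₉^×`, the quartic residue symbol `χ₄ = (·/3)₄`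
(`χ₄(c) ≡ c² (mod 3)`: `χ₄(±1) = 1`, `χ₄(±i) = −1`, `χ₄(±(1+i)) = −i`, `χ₄(±(1−i)) = i`) and its conjugate `χ̄₄` (the sums are written
out term by term; no definitions are introduced):

* `weierstrassP_third_mul_one_add_I_third` (P4.0) — **`℘(1/3) · ℘((1+i)/3) = −i ϖ₀⁴/√3`**: the one genuinely new constant (the RELATIVE
  sign of the two `3`-division values), from complex multiplication by `1 + i` (`GaussianLattice.weierstrassP_one_add_I_mul`:
  `℘((1+i)u) = −i(℘(u)² − ϖ₀⁴)/(2℘(u))`) and `℘(1/3)² = (3 + 2√3)ϖ₀⁴/3`;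
* `quarticSum_eq` (P4.1) — **`∑_v χ₄(3v) E₁*(w + v) = 6(√3 − 1) ℘(1/3) (℘(w)² + ϖ₀⁴) ℘'(w)/D(w)`**;
* `quarticConjSum_eq` (P4.2) — **`∑_v χ̄₄(3v) E₁*(w + v) = 2(3 − √3) ℘(1/3) (3℘(w)² − ϖ₀⁴) ℘'(w)/D(w)`**,
  for `w ∉ Λ` with `D(w) ≠ 0`. Proof: exactly as for `κ` — pair `v` with `−v` (`GaussianLattice.kroneckerE₁_add_add_sub`:
  `E₁*(w+v) + E₁*(w−v) − 2E₁*(w) = ℘'(w)/(℘(w) − ℘(v))`; the `E₁*(w)` terms cancel because `∑ χ₄ = 0`), leaving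
  `2℘'(w)[P₁/(℘² − P₁²) ∓ iP₂/(℘² − P₂²)]`; then only `P₁²`, `P₂² = (3 ∓ 2√3)ϖ₀⁴/3` and `P₁P₂ = −iϖ₀⁴/√3` enter;
* `weierstrassP_third_eq` — `℘(1/3) = +√((3 + 2√3)/3) · ϖ₀²` (sign: `℘` decreases on `(0, ½]`, `℘(1/2) = ϖ₀² > 0`);
* `quarticSum_quarter`, `quarticConjSum_quarter` (P4.3/P4.4 in algebraic form) — the values at the `4`-torsion point `w = 1/4`:
  `−3√2(√3−1)℘(1/3)/ϖ₀` and `−(2+√2)(3−√3)℘(1/3)/ϖ₀`;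
* `quarticSum_constants_pow_four` — `(3(√3−1)℘(1/3)/ϖ₀²)⁴ = 108 = 2²·3³` and `((3−√3)℘(1/3)/ϖ₀²)⁴ = 12 = 2²·3`, i.e. the constants are
  `√2·3^{3/4}` and `√2·3^{1/4}` times `ϖ₀²/3` resp. `ϖ₀²`: in the coordinates `x = ℘/ϖ₀²`, `y = ℘'/(2ϖ₀³)` of `y² = x³ − x` the three sums
  are `4√2·3^{3/4}·ϖ₀(x²+1)y/δ`, `4√2·3^{1/4}·ϖ₀(3x²−1)y/δ`, `16√3·ϖ₀xy/δ` (`δ = 3x⁴−6x²−1`) — `3`-adic orders of the constants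
  EXACTLY `3/4`, `1/4`, `1/2` = the deficits `1 − k/4` (`k = v₃(D) = 1, 3, 2`) of the stub plan (memo EPSILON-RESOLVED §7 table (R)).

HONEST FRAMING: these are identities between elliptic-function values on `ℂ/(ℤi + ℤ)`; nothing here proves the registered stub, the crux
`InertBadAtThree`, any instance of F-es-18, or BSD. No definitions, no named facts; axioms standard.
-/

set_option linter.dupNamespace false

noncomputable section

open Complex PeriodPair Real Set Filter
open scoped Real Topology PeriodPair ComplexConjugate

namespace Summit.BirchSwinnertonDyer.BirchSwinnertonDyer.Theorems.InertBadSignedBranchesInertBadAtThreeQuarticTorsionSums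

open Literature.NumberTheory.EllipticCurves Literature.NumberTheory.EllipticCurves.GaussianLattice

/-! ### Constants: `√3`, `ϖ₀`, `℘(1/3)` -/

/-- `(√3)² = 3` in `ℂ`. [folklore] -/
private theorem sqrt_three_sq'' : ((Real.sqrt 3 : ℝ) : ℂ) ^ 2 = 3 := by
  rw [← Complex.ofReal_pow, Real.sq_sqrt (by norm_num)]; push_cast; ring

/-- `√3 ≠ 0` in `ℂ`. [folklore] -/
private theorem sqrt_three_ne_zero : ((Real.sqrt 3 : ℝ) : ℂ) ≠ 0 := by
  rw [Complex.ofReal_ne_zero]; positivity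

/-- `ϖ₀ ≠ 0` in `ℂ` (local copy of `varpi_complex_ne_zero` in the file's notation). [folklore] -/
private theorem varpi_ne_zero' : ((Real.Gamma (1 / 4) ^ 2 / (2 * Real.sqrt (2 * π)) : ℝ) : ℂ) ≠ 0 :=
  Complex.ofReal_ne_zero.mpr varpi_pos.ne'

/-- **`℘(1/3) = √((3 + 2√3)/3) · ϖ₀²`, with the positive square root**: `℘(1/3)` is real,
`℘(1/3)² = (3 + 2√3)ϖ₀⁴/3` (`weierstrassP_third_sq`), and `℘(1/3) > 0` because `℘` is strictly
decreasing on the real half-period `(0, ½]` (`PeriodPair.IsReal.strictAntiOn_weierstrassPRe`)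
with `℘(1/2) = ϖ₀² > 0`. [folklore] -/
theorem weierstrassP_third_eq :
    ℘[ofUpperHalfPlane UpperHalfPlane.I] (1 / 3) = ((Real.sqrt ((3 + 2 * Real.sqrt 3) / 3) * (Real.Gamma (1 / 4) ^ 2 / (2 * Real.sqrt (2 * π)) : ℝ) ^ 2 : ℝ) : ℂ) := by
  set p : ℝ := (ofUpperHalfPlane UpperHalfPlane.I).weierstrassPRe (1 / 3) with hp
  have hP : ℘[ofUpperHalfPlane UpperHalfPlane.I] (1 / 3) = (p : ℂ) := by
    rw [hp, isReal.ofReal_weierstrassPRe]; push_cast; ring_nf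
  -- `p > ℘(1/2) = ϖ₀² > 0`
  have hmono := isReal.strictAntiOn_weierstrassPRe (L := ofUpperHalfPlane UpperHalfPlane.I)
  rw [minRealPeriod_eq] at hmono
  have hlt : (ofUpperHalfPlane UpperHalfPlane.I).weierstrassPRe (1 / 2) < p :=
    hmono ⟨by norm_num, by norm_num⟩ ⟨by norm_num, by norm_num⟩ (by norm_num)
  rw [weierstrassPRe_half_eq_varpi_sq] at hlt
  have hpos : 0 < p := lt_trans (pow_pos varpi_pos 2) hlt
  -- squares agree
  have hsq : (p : ℂ) ^ 2 = (((3 + 2 * Real.sqrt 3) / 3 * (Real.Gamma (1 / 4) ^ 2 / (2 * Real.sqrt (2 * π)) : ℝ) ^ 4 : ℝ) : ℂ) := by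
    rw [← hP, weierstrassP_third_sq]
  have hsq' : p ^ 2 = (3 + 2 * Real.sqrt 3) / 3 * (Real.Gamma (1 / 4) ^ 2 / (2 * Real.sqrt (2 * π)) : ℝ) ^ 4 := by exact_mod_cast hsq
  have hnn : 0 ≤ (3 + 2 * Real.sqrt 3) / 3 := by positivity
  have hroot : p = Real.sqrt ((3 + 2 * Real.sqrt 3) / 3) * (Real.Gamma (1 / 4) ^ 2 / (2 * Real.sqrt (2 * π)) : ℝ) ^ 2 := by
    have h2 : (Real.sqrt ((3 + 2 * Real.sqrt 3) / 3) * (Real.Gamma (1 / 4) ^ 2 / (2 * Real.sqrt (2 * π)) : ℝ) ^ 2) ^ 2 = p ^ 2 := by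
      rw [mul_pow, Real.sq_sqrt hnn, hsq']; ring
    have hnn' : 0 ≤ Real.sqrt ((3 + 2 * Real.sqrt 3) / 3) * (Real.Gamma (1 / 4) ^ 2 / (2 * Real.sqrt (2 * π)) : ℝ) ^ 2 := by positivity
    exact ((pow_left_inj₀ hpos.le hnn' two_ne_zero).mp h2.symm)
  rw [hP, hroot]

/-- `℘(1/3) ≠ 0`. [folklore] -/
theorem weierstrassP_third_ne_zero : ℘[ofUpperHalfPlane UpperHalfPlane.I] (1 / 3) ≠ 0 := by
  rw [weierstrassP_third_eq, Complex.ofReal_ne_zero]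
  have h1 : 0 < Real.sqrt ((3 + 2 * Real.sqrt 3) / 3) := Real.sqrt_pos.mpr (by positivity)
  have h2 := varpi_pos
  positivity

/-- **`℘(1/3) · ℘((1+i)/3) = −i ϖ₀⁴/√3`** — the relative sign of the two `3`-division values of the
Gaussian lattice: complex multiplication by `1 + i` (`weierstrassP_one_add_I_mul`,
`℘((1+i)u) = −i(℘(u)² − ϖ₀⁴)/(2℘(u))` at `u = 1/3`) and `℘(1/3)² = (3 + 2√3)ϖ₀⁴/3`. Only `℘(1/3)²`
enters, so no sign of `℘(1/3)` is needed. [cite: BirchSwinnertonDyer1965NotesII, §3 (3.12)] -/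
theorem weierstrassP_third_mul_one_add_I_third :
    ℘[ofUpperHalfPlane UpperHalfPlane.I] (1 / 3) * ℘[ofUpperHalfPlane UpperHalfPlane.I] ((1 + I) / 3) = -I * ((Real.Gamma (1 / 4) ^ 2 / (2 * Real.sqrt (2 * π)) : ℝ) : ℂ) ^ 4 / (Real.sqrt 3 : ℂ) := by
  have h := weierstrassP_one_add_I_mul one_third_notMem weierstrassP_third_ne_zero
  rw [show (1 + I) * (1 / 3 : ℂ) = (1 + I) / 3 by ring] at h
  set P₁ := ℘[ofUpperHalfPlane UpperHalfPlane.I] (1 / 3) with hP₁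
  set ϖ : ℂ := ((Real.Gamma (1 / 4) ^ 2 / (2 * Real.sqrt (2 * π)) : ℝ) : ℂ) with hϖ
  set s : ℂ := (Real.sqrt 3 : ℂ) with hs
  have hs2 : s ^ 2 = 3 := sqrt_three_sq''
  have hs0 : s ≠ 0 := sqrt_three_ne_zero
  have h1 : P₁ ^ 2 = (3 + 2 * s) / 3 * ϖ ^ 4 := by
    rw [hP₁, weierstrassP_third_sq, hs, hϖ]; push_cast; ring
  have hP0 : P₁ ≠ 0 := weierstrassP_third_ne_zero
  rw [h, ← mul_div_assoc, div_eq_div_iff (mul_ne_zero two_ne_zero hP0) hs0]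
  linear_combination (-I * s * P₁) * h1 + (-(2:ℂ) / 3 * I * ϖ ^ 4 * P₁) * hs2

/-! ### The two quartic-twisted sums -/

/-- The common skeleton of both evaluations: for `w ∉ Λ` with `D(w) ≠ 0`, the four pair sums
`E₁*(w+v) + E₁*(w−v) − 2E₁*(w)` over `v = 1/3, i/3, (1+i)/3, (1−i)/3` are
`℘'(w)/(℘(w) ∓ P₁)`, `℘'(w)/(℘(w) ∓ P₂)`, and the four denominators are non-zero. [folklore] -/
private theorem pair_sums {w : ℂ} (hw : w ∉ (ofUpperHalfPlane UpperHalfPlane.I).lattice)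
    (hD : 3 * ℘[ofUpperHalfPlane UpperHalfPlane.I] w ^ 4 - 6 * ((Real.Gamma (1 / 4) ^ 2 / (2 * Real.sqrt (2 * π)) : ℝ) : ℂ) ^ 4 * ℘[ofUpperHalfPlane UpperHalfPlane.I] w ^ 2 - ((Real.Gamma (1 / 4) ^ 2 / (2 * Real.sqrt (2 * π)) : ℝ) : ℂ) ^ 8 ≠ 0) :
    (kroneckerE₁ (w + 1 / 3) + kroneckerE₁ (w - 1 / 3) - 2 * kroneckerE₁ w =
        ℘'[ofUpperHalfPlane UpperHalfPlane.I] w / (℘[ofUpperHalfPlane UpperHalfPlane.I] w - ℘[ofUpperHalfPlane UpperHalfPlane.I] (1 / 3))) ∧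
    (kroneckerE₁ (w + I / 3) + kroneckerE₁ (w - I / 3) - 2 * kroneckerE₁ w =
        ℘'[ofUpperHalfPlane UpperHalfPlane.I] w / (℘[ofUpperHalfPlane UpperHalfPlane.I] w + ℘[ofUpperHalfPlane UpperHalfPlane.I] (1 / 3))) ∧
    (kroneckerE₁ (w + (1 + I) / 3) + kroneckerE₁ (w - (1 + I) / 3) - 2 * kroneckerE₁ w =
        ℘'[ofUpperHalfPlane UpperHalfPlane.I] w / (℘[ofUpperHalfPlane UpperHalfPlane.I] w - ℘[ofUpperHalfPlane UpperHalfPlane.I] ((1 + I) / 3))) ∧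
    (kroneckerE₁ (w + (1 - I) / 3) + kroneckerE₁ (w - (1 - I) / 3) - 2 * kroneckerE₁ w =
        ℘'[ofUpperHalfPlane UpperHalfPlane.I] w / (℘[ofUpperHalfPlane UpperHalfPlane.I] w + ℘[ofUpperHalfPlane UpperHalfPlane.I] ((1 + I) / 3))) ∧
    ℘[ofUpperHalfPlane UpperHalfPlane.I] w - ℘[ofUpperHalfPlane UpperHalfPlane.I] (1 / 3) ≠ 0 ∧ ℘[ofUpperHalfPlane UpperHalfPlane.I] w + ℘[ofUpperHalfPlane UpperHalfPlane.I] (1 / 3) ≠ 0 ∧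
    ℘[ofUpperHalfPlane UpperHalfPlane.I] w - ℘[ofUpperHalfPlane UpperHalfPlane.I] ((1 + I) / 3) ≠ 0 ∧ ℘[ofUpperHalfPlane UpperHalfPlane.I] w + ℘[ofUpperHalfPlane UpperHalfPlane.I] ((1 + I) / 3) ≠ 0 := by
  set P := ℘[ofUpperHalfPlane UpperHalfPlane.I] w with hP
  set P₁ := ℘[ofUpperHalfPlane UpperHalfPlane.I] (1 / 3) with hP₁
  set P₂ := ℘[ofUpperHalfPlane UpperHalfPlane.I] ((1 + I) / 3) with hP₂
  set ϖ : ℂ := ((Real.Gamma (1 / 4) ^ 2 / (2 * Real.sqrt (2 * π)) : ℝ) : ℂ) with hϖ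
  set s : ℂ := (Real.sqrt 3 : ℂ) with hs
  have hs2 : s ^ 2 = 3 := sqrt_three_sq''
  have h1 : P₁ ^ 2 = (3 + 2 * s) / 3 * ϖ ^ 4 := by
    rw [hP₁, weierstrassP_third_sq, hs, hϖ]; push_cast; ring
  have h2 : P₂ ^ 2 = (3 - 2 * s) / 3 * ϖ ^ 4 := by
    rw [hP₂, weierstrassP_one_add_I_third_sq, hs, hϖ]; push_cast; ring
  have hfac : 3 * P ^ 4 - 6 * ϖ ^ 4 * P ^ 2 - ϖ ^ 8 = 3 * (P ^ 2 - P₁ ^ 2) * (P ^ 2 - P₂ ^ 2) := by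
    rw [h1, h2]; linear_combination (4 / 3 : ℂ) * ϖ ^ 8 * hs2
  have hD' : 3 * (P ^ 2 - P₁ ^ 2) * (P ^ 2 - P₂ ^ 2) ≠ 0 := hfac ▸ hD
  have hA : P ^ 2 - P₁ ^ 2 ≠ 0 := fun h ↦ hD' (by rw [h]; ring)
  have hB : P ^ 2 - P₂ ^ 2 ≠ 0 := fun h ↦ hD' (by rw [h]; ring)
  have hne1 : P - P₁ ≠ 0 := fun h ↦ hA (by linear_combination (P + P₁) * h)
  have hne1' : P + P₁ ≠ 0 := fun h ↦ hA (by linear_combination (P - P₁) * h)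
  have hne2 : P - P₂ ≠ 0 := fun h ↦ hB (by linear_combination (P + P₂) * h)
  have hne2' : P + P₂ ≠ 0 := fun h ↦ hB (by linear_combination (P - P₂) * h)
  have e1 := kroneckerE₁_add_add_sub hw one_third_notMem (sub_ne_zero.mp hne1)
  have e2 := kroneckerE₁_add_add_sub hw I_third_notMem (v := I / 3)
    (by rw [weierstrassP_I_third]; exact fun h ↦ hne1' (by rw [hP, hP₁]; linear_combination h))
  have e3 := kroneckerE₁_add_add_sub hw one_add_I_third_notMem (sub_ne_zero.mp hne2)
  have e4 := kroneckerE₁_add_add_sub hw one_sub_I_third_notMem (v := (1 - I) / 3)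
    (by rw [weierstrassP_one_sub_I_third]; exact fun h ↦ hne2' (by rw [hP, hP₂]; linear_combination h))
  rw [weierstrassP_I_third, ← hP, ← hP₁, sub_neg_eq_add] at e2
  rw [weierstrassP_one_sub_I_third, ← hP, ← hP₂, sub_neg_eq_add] at e4
  exact ⟨e1, e2, e3, e4, hne1, hne1', hne2, hne2'⟩

/-- **Evaluation of the `χ₄`-twisted `3`-torsion sum**: for `w ∉ Λ` with
`D(w) = 3℘(w)⁴ − 6ϖ₀⁴℘(w)² − ϖ₀⁸ ≠ 0`,
`∑_v χ₄(3v) E₁*(w + v) = 6(√3 − 1) ℘(1/3) (℘(w)² + ϖ₀⁴) ℘'(w) / D(w)`.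
Pairing `v` with `−v` gives `2℘'(w)[P₁/(℘² − P₁²) − iP₂/(℘² − P₂²)]` (`P₁ = ℘(1/3)`,
`P₂ = ℘((1+i)/3)`); multiplying the bracket by `P₁` only `P₁² = (3+2√3)ϖ₀⁴/3`,
`P₂² = (3−2√3)ϖ₀⁴/3` and `P₁P₂ = −iϖ₀⁴/√3` enter. In the coordinates `x = ℘/ϖ₀²`,
`y = ℘'/(2ϖ₀³)` of `y² = x³ − x` this reads `12(√3−1)(P₁/ϖ₀²) ϖ₀ (x²+1)y/(3x⁴−6x²−1)`
(`quarticSum_eq_coord`). [folklore] -/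
theorem quarticSum_eq {w : ℂ} (hw : w ∉ (ofUpperHalfPlane UpperHalfPlane.I).lattice)
    (hD : 3 * ℘[ofUpperHalfPlane UpperHalfPlane.I] w ^ 4 - 6 * ((Real.Gamma (1 / 4) ^ 2 / (2 * Real.sqrt (2 * π)) : ℝ) : ℂ) ^ 4 * ℘[ofUpperHalfPlane UpperHalfPlane.I] w ^ 2 - ((Real.Gamma (1 / 4) ^ 2 / (2 * Real.sqrt (2 * π)) : ℝ) : ℂ) ^ 8 ≠ 0) :
    (kroneckerE₁ (w + 1 / 3) + kroneckerE₁ (w - 1 / 3) -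
      (kroneckerE₁ (w + I / 3) + kroneckerE₁ (w - I / 3)) -
      I * (kroneckerE₁ (w + (1 + I) / 3) + kroneckerE₁ (w - (1 + I) / 3)) +
      I * (kroneckerE₁ (w + (1 - I) / 3) + kroneckerE₁ (w - (1 - I) / 3))) =
      6 * ((Real.sqrt 3 : ℂ) - 1) * ℘[ofUpperHalfPlane UpperHalfPlane.I] (1 / 3) * (℘[ofUpperHalfPlane UpperHalfPlane.I] w ^ 2 + ((Real.Gamma (1 / 4) ^ 2 / (2 * Real.sqrt (2 * π)) : ℝ) : ℂ) ^ 4) * ℘'[ofUpperHalfPlane UpperHalfPlane.I] w /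
        (3 * ℘[ofUpperHalfPlane UpperHalfPlane.I] w ^ 4 - 6 * ((Real.Gamma (1 / 4) ^ 2 / (2 * Real.sqrt (2 * π)) : ℝ) : ℂ) ^ 4 * ℘[ofUpperHalfPlane UpperHalfPlane.I] w ^ 2 - ((Real.Gamma (1 / 4) ^ 2 / (2 * Real.sqrt (2 * π)) : ℝ) : ℂ) ^ 8) := by
  obtain ⟨e1, e2, e3, e4, hne1, hne1', hne2, hne2'⟩ := pair_sums hw hD
  set P := ℘[ofUpperHalfPlane UpperHalfPlane.I] w with hP
  set Q := ℘'[ofUpperHalfPlane UpperHalfPlane.I] w with hQ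
  set P₁ := ℘[ofUpperHalfPlane UpperHalfPlane.I] (1 / 3) with hP₁
  set P₂ := ℘[ofUpperHalfPlane UpperHalfPlane.I] ((1 + I) / 3) with hP₂
  set ϖ : ℂ := ((Real.Gamma (1 / 4) ^ 2 / (2 * Real.sqrt (2 * π)) : ℝ) : ℂ) with hϖ
  set s : ℂ := (Real.sqrt 3 : ℂ) with hs
  have hs2 : s ^ 2 = 3 := sqrt_three_sq''
  have h1 : P₁ ^ 2 = (3 + 2 * s) / 3 * ϖ ^ 4 := by
    rw [hP₁, weierstrassP_third_sq, hs, hϖ]; push_cast; ring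
  have h2 : P₂ ^ 2 = (3 - 2 * s) / 3 * ϖ ^ 4 := by
    rw [hP₂, weierstrassP_one_add_I_third_sq, hs, hϖ]; push_cast; ring
  have h12 : P₁ * P₂ = -I * s * ϖ ^ 4 / 3 := by
    rw [hP₁, hP₂, weierstrassP_third_mul_one_add_I_third, ← hϖ, ← hs,
      div_eq_div_iff sqrt_three_ne_zero three_ne_zero]
    linear_combination (I * ϖ ^ 4) * hs2
  have hfac : 3 * P ^ 4 - 6 * ϖ ^ 4 * P ^ 2 - ϖ ^ 8 = 3 * (P ^ 2 - P₁ ^ 2) * (P ^ 2 - P₂ ^ 2) := by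
    rw [h1, h2]; linear_combination (4 / 3 : ℂ) * ϖ ^ 8 * hs2
  have hD' : 3 * (P ^ 2 - P₁ ^ 2) * (P ^ 2 - P₂ ^ 2) ≠ 0 := hfac ▸ hD
  have hA : P ^ 2 - P₁ ^ 2 ≠ 0 := fun h ↦ hD' (by rw [h]; ring)
  have hB : P ^ 2 - P₂ ^ 2 ≠ 0 := fun h ↦ hD' (by rw [h]; ring)
  have hP10 : P₁ ≠ 0 := weierstrassP_third_ne_zero
  -- the bracket identity, multiplied by `P₁`
  have hbrP : P₁ * (2 * P₁ * (P ^ 2 - P₂ ^ 2) - I * (2 * P₂ * (P ^ 2 - P₁ ^ 2))) =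
      P₁ * (2 * (s - 1) * P₁ * (P ^ 2 + ϖ ^ 4)) := by
    linear_combination (-2 * I * P ^ 2 + 2 * I * P₁ ^ 2) * h12 +
      (2 * s * ϖ ^ 4 / 3 * P ^ 2 - 2 * s * ϖ ^ 4 / 3 * P₁ ^ 2) * I_sq + (-2 * P₁ ^ 2) * h2 +
      ((4 - 2 * s) * P ^ 2) * h1 + (-4 * P ^ 2 * ϖ ^ 4 / 3) * hs2
  have hbr : 2 * P₁ * (P ^ 2 - P₂ ^ 2) - I * (2 * P₂ * (P ^ 2 - P₁ ^ 2)) =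
      2 * (s - 1) * P₁ * (P ^ 2 + ϖ ^ 4) :=
    mul_left_cancel₀ hP10 hbrP
  have key : (kroneckerE₁ (w + 1 / 3) + kroneckerE₁ (w - 1 / 3) -
      (kroneckerE₁ (w + I / 3) + kroneckerE₁ (w - I / 3)) -
      I * (kroneckerE₁ (w + (1 + I) / 3) + kroneckerE₁ (w - (1 + I) / 3)) +
      I * (kroneckerE₁ (w + (1 - I) / 3) + kroneckerE₁ (w - (1 - I) / 3))) =
      Q / (P - P₁) - Q / (P + P₁) - I * (Q / (P - P₂)) + I * (Q / (P + P₂)) := by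
    linear_combination e1 - e2 - I * e3 + I * e4
  have eA : Q / (P - P₁) - Q / (P + P₁) = 2 * P₁ * Q / (P ^ 2 - P₁ ^ 2) := by
    rw [div_sub_div _ _ hne1 hne1', show (P - P₁) * (P + P₁) = P ^ 2 - P₁ ^ 2 by ring]
    congr 1; ring
  have eB : I * (Q / (P - P₂)) - I * (Q / (P + P₂)) = I * (2 * P₂ * Q) / (P ^ 2 - P₂ ^ 2) := by
    rw [← mul_sub, div_sub_div _ _ hne2 hne2', show (P - P₂) * (P + P₂) = P ^ 2 - P₂ ^ 2 by ring,
      ← mul_div_assoc]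
    congr 1; ring
  rw [key, show Q / (P - P₁) - Q / (P + P₁) - I * (Q / (P - P₂)) + I * (Q / (P + P₂))
      = (Q / (P - P₁) - Q / (P + P₁)) - (I * (Q / (P - P₂)) - I * (Q / (P + P₂))) by ring,
    eA, eB, hfac, div_sub_div _ _ hA hB, div_eq_div_iff (mul_ne_zero hA hB) hD']
  linear_combination (3 * Q * (P ^ 2 - P₁ ^ 2) * (P ^ 2 - P₂ ^ 2)) * hbr

/-- **Evaluation of the `χ̄₄`-twisted `3`-torsion sum**: for `w ∉ Λ` with `D(w) ≠ 0`,
`∑_v χ̄₄(3v) E₁*(w + v) = 2(3 − √3) ℘(1/3) (3℘(w)² − ϖ₀⁴) ℘'(w) / D(w)`; in coordinates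
`4(3−√3)(P₁/ϖ₀²) ϖ₀ (3x²−1)y/(3x⁴−6x²−1)` (`quarticConjSum_eq_coord`). Same proof with
the bracket `P₁/(℘² − P₁²) + iP₂/(℘² − P₂²)`. [folklore] -/
theorem quarticConjSum_eq {w : ℂ} (hw : w ∉ (ofUpperHalfPlane UpperHalfPlane.I).lattice)
    (hD : 3 * ℘[ofUpperHalfPlane UpperHalfPlane.I] w ^ 4 - 6 * ((Real.Gamma (1 / 4) ^ 2 / (2 * Real.sqrt (2 * π)) : ℝ) : ℂ) ^ 4 * ℘[ofUpperHalfPlane UpperHalfPlane.I] w ^ 2 - ((Real.Gamma (1 / 4) ^ 2 / (2 * Real.sqrt (2 * π)) : ℝ) : ℂ) ^ 8 ≠ 0) :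
    (kroneckerE₁ (w + 1 / 3) + kroneckerE₁ (w - 1 / 3) -
      (kroneckerE₁ (w + I / 3) + kroneckerE₁ (w - I / 3)) +
      I * (kroneckerE₁ (w + (1 + I) / 3) + kroneckerE₁ (w - (1 + I) / 3)) -
      I * (kroneckerE₁ (w + (1 - I) / 3) + kroneckerE₁ (w - (1 - I) / 3))) =
      2 * (3 - (Real.sqrt 3 : ℂ)) * ℘[ofUpperHalfPlane UpperHalfPlane.I] (1 / 3) * (3 * ℘[ofUpperHalfPlane UpperHalfPlane.I] w ^ 2 - ((Real.Gamma (1 / 4) ^ 2 / (2 * Real.sqrt (2 * π)) : ℝ) : ℂ) ^ 4) * ℘'[ofUpperHalfPlane UpperHalfPlane.I] w /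
        (3 * ℘[ofUpperHalfPlane UpperHalfPlane.I] w ^ 4 - 6 * ((Real.Gamma (1 / 4) ^ 2 / (2 * Real.sqrt (2 * π)) : ℝ) : ℂ) ^ 4 * ℘[ofUpperHalfPlane UpperHalfPlane.I] w ^ 2 - ((Real.Gamma (1 / 4) ^ 2 / (2 * Real.sqrt (2 * π)) : ℝ) : ℂ) ^ 8) := by
  obtain ⟨e1, e2, e3, e4, hne1, hne1', hne2, hne2'⟩ := pair_sums hw hD
  set P := ℘[ofUpperHalfPlane UpperHalfPlane.I] w with hP
  set Q := ℘'[ofUpperHalfPlane UpperHalfPlane.I] w with hQ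
  set P₁ := ℘[ofUpperHalfPlane UpperHalfPlane.I] (1 / 3) with hP₁
  set P₂ := ℘[ofUpperHalfPlane UpperHalfPlane.I] ((1 + I) / 3) with hP₂
  set ϖ : ℂ := ((Real.Gamma (1 / 4) ^ 2 / (2 * Real.sqrt (2 * π)) : ℝ) : ℂ) with hϖ
  set s : ℂ := (Real.sqrt 3 : ℂ) with hs
  have hs2 : s ^ 2 = 3 := sqrt_three_sq''
  have h1 : P₁ ^ 2 = (3 + 2 * s) / 3 * ϖ ^ 4 := by
    rw [hP₁, weierstrassP_third_sq, hs, hϖ]; push_cast; ring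
  have h2 : P₂ ^ 2 = (3 - 2 * s) / 3 * ϖ ^ 4 := by
    rw [hP₂, weierstrassP_one_add_I_third_sq, hs, hϖ]; push_cast; ring
  have h12 : P₁ * P₂ = -I * s * ϖ ^ 4 / 3 := by
    rw [hP₁, hP₂, weierstrassP_third_mul_one_add_I_third, ← hϖ, ← hs,
      div_eq_div_iff sqrt_three_ne_zero three_ne_zero]
    linear_combination (I * ϖ ^ 4) * hs2
  have hfac : 3 * P ^ 4 - 6 * ϖ ^ 4 * P ^ 2 - ϖ ^ 8 = 3 * (P ^ 2 - P₁ ^ 2) * (P ^ 2 - P₂ ^ 2) := by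
    rw [h1, h2]; linear_combination (4 / 3 : ℂ) * ϖ ^ 8 * hs2
  have hD' : 3 * (P ^ 2 - P₁ ^ 2) * (P ^ 2 - P₂ ^ 2) ≠ 0 := hfac ▸ hD
  have hA : P ^ 2 - P₁ ^ 2 ≠ 0 := fun h ↦ hD' (by rw [h]; ring)
  have hB : P ^ 2 - P₂ ^ 2 ≠ 0 := fun h ↦ hD' (by rw [h]; ring)
  have hP10 : P₁ ≠ 0 := weierstrassP_third_ne_zero
  have hbrP : P₁ * (2 * P₁ * (P ^ 2 - P₂ ^ 2) + I * (2 * P₂ * (P ^ 2 - P₁ ^ 2))) =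
      P₁ * (2 / 3 * (3 - s) * P₁ * (3 * P ^ 2 - ϖ ^ 4)) := by
    linear_combination (2 * I * P ^ 2 - 2 * I * P₁ ^ 2) * h12 +
      (-2 * s * ϖ ^ 4 / 3 * P ^ 2 + 2 * s * ϖ ^ 4 / 3 * P₁ ^ 2) * I_sq + (-2 * P₁ ^ 2) * h2 +
      ((2 * s - 4) * P ^ 2) * h1 + (4 * P ^ 2 * ϖ ^ 4 / 3) * hs2
  have hbr : 2 * P₁ * (P ^ 2 - P₂ ^ 2) + I * (2 * P₂ * (P ^ 2 - P₁ ^ 2)) =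
      2 / 3 * (3 - s) * P₁ * (3 * P ^ 2 - ϖ ^ 4) :=
    mul_left_cancel₀ hP10 hbrP
  have key : (kroneckerE₁ (w + 1 / 3) + kroneckerE₁ (w - 1 / 3) -
      (kroneckerE₁ (w + I / 3) + kroneckerE₁ (w - I / 3)) +
      I * (kroneckerE₁ (w + (1 + I) / 3) + kroneckerE₁ (w - (1 + I) / 3)) -
      I * (kroneckerE₁ (w + (1 - I) / 3) + kroneckerE₁ (w - (1 - I) / 3))) =
      Q / (P - P₁) - Q / (P + P₁) + I * (Q / (P - P₂)) - I * (Q / (P + P₂)) := by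
    linear_combination e1 - e2 + I * e3 - I * e4
  have eA : Q / (P - P₁) - Q / (P + P₁) = 2 * P₁ * Q / (P ^ 2 - P₁ ^ 2) := by
    rw [div_sub_div _ _ hne1 hne1', show (P - P₁) * (P + P₁) = P ^ 2 - P₁ ^ 2 by ring]
    congr 1; ring
  have eB : I * (Q / (P - P₂)) - I * (Q / (P + P₂)) = I * (2 * P₂ * Q) / (P ^ 2 - P₂ ^ 2) := by
    rw [← mul_sub, div_sub_div _ _ hne2 hne2', show (P - P₂) * (P + P₂) = P ^ 2 - P₂ ^ 2 by ring,
      ← mul_div_assoc]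
    congr 1; ring
  rw [key, show Q / (P - P₁) - Q / (P + P₁) + I * (Q / (P - P₂)) - I * (Q / (P + P₂))
      = (Q / (P - P₁) - Q / (P + P₁)) + (I * (Q / (P - P₂)) - I * (Q / (P + P₂))) by ring,
    eA, eB, hfac, div_add_div _ _ hA hB, div_eq_div_iff (mul_ne_zero hA hB) hD']
  linear_combination (3 * Q * (P ^ 2 - P₁ ^ 2) * (P ^ 2 - P₂ ^ 2)) * hbr

/-! ### The first rung: values at the quarter point `w = 1/4` (`x = 1 + √2`, `y = −√2(1+√2)`) -/

/-- `(√2)² = 2` in `ℂ`. [folklore] -/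
private theorem sqrt_two_sq'' : ((Real.sqrt 2 : ℝ) : ℂ) ^ 2 = 2 := by
  rw [← Complex.ofReal_pow, Real.sq_sqrt (by norm_num)]; push_cast; ring

/-- `D(1/4) ≠ 0`. [folklore] -/
private theorem threeDiv_quarter_ne_zero :
    3 * ℘[ofUpperHalfPlane UpperHalfPlane.I] (1 / 4) ^ 4 - 6 * ((Real.Gamma (1 / 4) ^ 2 / (2 * Real.sqrt (2 * π)) : ℝ) : ℂ) ^ 4 * ℘[ofUpperHalfPlane UpperHalfPlane.I] (1 / 4) ^ 2 - ((Real.Gamma (1 / 4) ^ 2 / (2 * Real.sqrt (2 * π)) : ℝ) : ℂ) ^ 8 ≠ 0 := by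
  rw [threeDiv_quarter]
  exact mul_ne_zero (mul_ne_zero (by norm_num) four_add_sub_three_sqrt_two_ne_zero.1)
    (pow_ne_zero _ varpi_ne_zero')

/-- **`∑_v χ₄(3v) E₁*(1/4 + v) = −3√2(√3 − 1) ℘(1/3)/ϖ₀`** (`= −2·3^{3/4}ϖ₀`, since
`(3(√3−1)℘(1/3)/ϖ₀²)⁴ = 108 = (√2·3^{3/4})⁴` and `℘(1/3) > 0`): the bound `3/4` on the `3`-adic
order of the `χ₄`-sum is attained at the `4`-torsion point `1/4` (`℘(1/4) = (1+√2)ϖ₀²`,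
`℘'(1/4) = −2√2(1+√2)ϖ₀³`, `D(1/4) = 8(4+3√2)ϖ₀⁸`). [folklore] -/
theorem quarticSum_quarter :
    (kroneckerE₁ ((1 / 4 : ℂ) + 1 / 3) + kroneckerE₁ ((1 / 4 : ℂ) - 1 / 3) -
      (kroneckerE₁ ((1 / 4 : ℂ) + I / 3) + kroneckerE₁ ((1 / 4 : ℂ) - I / 3)) -
      I * (kroneckerE₁ ((1 / 4 : ℂ) + (1 + I) / 3) + kroneckerE₁ ((1 / 4 : ℂ) - (1 + I) / 3)) +
      I * (kroneckerE₁ ((1 / 4 : ℂ) + (1 - I) / 3) + kroneckerE₁ ((1 / 4 : ℂ) - (1 - I) / 3))) =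
      -(3 * (Real.sqrt 2 : ℂ) * ((Real.sqrt 3 : ℂ) - 1) * ℘[ofUpperHalfPlane UpperHalfPlane.I] (1 / 3) / ((Real.Gamma (1 / 4) ^ 2 / (2 * Real.sqrt (2 * π)) : ℝ) : ℂ)) := by
  rw [quarticSum_eq one_quarter_notMem threeDiv_quarter_ne_zero, threeDiv_quarter,
    weierstrassP_quarter, derivWeierstrassP_quarter, ← neg_div,
    div_eq_div_iff (mul_ne_zero (mul_ne_zero (by norm_num) four_add_sub_three_sqrt_two_ne_zero.1)
      (pow_ne_zero _ varpi_ne_zero')) varpi_ne_zero']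
  set r : ℂ := (Real.sqrt 2 : ℂ) with hr
  set s : ℂ := (Real.sqrt 3 : ℂ) with hs
  set ϖ : ℂ := ((Real.Gamma (1 / 4) ^ 2 / (2 * Real.sqrt (2 * π)) : ℝ) : ℂ) with hϖ
  set P₁ := ℘[ofUpperHalfPlane UpperHalfPlane.I] (1 / 3) with hP₁
  have hr2 : r ^ 2 = 2 := sqrt_two_sq''
  linear_combination (-12 * r * (s - 1) * P₁ * ϖ ^ 8 * (r + 3)) * hr2

/-- **`∑_v χ̄₄(3v) E₁*(1/4 + v) = −(2 + √2)(3 − √3) ℘(1/3)/ϖ₀`** (`= −2(1+√2)·3^{1/4}ϖ₀`, since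
`((3−√3)℘(1/3)/ϖ₀²)⁴ = 12 = (√2·3^{1/4})⁴`): the bound `1/4` for the `χ̄₄`-sum is attained at
`w = 1/4`. [folklore] -/
theorem quarticConjSum_quarter :
    (kroneckerE₁ ((1 / 4 : ℂ) + 1 / 3) + kroneckerE₁ ((1 / 4 : ℂ) - 1 / 3) -
      (kroneckerE₁ ((1 / 4 : ℂ) + I / 3) + kroneckerE₁ ((1 / 4 : ℂ) - I / 3)) +
      I * (kroneckerE₁ ((1 / 4 : ℂ) + (1 + I) / 3) + kroneckerE₁ ((1 / 4 : ℂ) - (1 + I) / 3)) -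
      I * (kroneckerE₁ ((1 / 4 : ℂ) + (1 - I) / 3) + kroneckerE₁ ((1 / 4 : ℂ) - (1 - I) / 3))) =
      -((2 + (Real.sqrt 2 : ℂ)) * (3 - (Real.sqrt 3 : ℂ)) * ℘[ofUpperHalfPlane UpperHalfPlane.I] (1 / 3) / ((Real.Gamma (1 / 4) ^ 2 / (2 * Real.sqrt (2 * π)) : ℝ) : ℂ)) := by
  rw [quarticConjSum_eq one_quarter_notMem threeDiv_quarter_ne_zero, threeDiv_quarter,
    weierstrassP_quarter, derivWeierstrassP_quarter, ← neg_div,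
    div_eq_div_iff (mul_ne_zero (mul_ne_zero (by norm_num) four_add_sub_three_sqrt_two_ne_zero.1)
      (pow_ne_zero _ varpi_ne_zero')) varpi_ne_zero']
  set r : ℂ := (Real.sqrt 2 : ℂ) with hr
  set s : ℂ := (Real.sqrt 3 : ℂ) with hs
  set ϖ : ℂ := ((Real.Gamma (1 / 4) ^ 2 / (2 * Real.sqrt (2 * π)) : ℝ) : ℂ) with hϖ
  set P₁ := ℘[ofUpperHalfPlane UpperHalfPlane.I] (1 / 3) with hP₁
  have hr2 : r ^ 2 = 2 := sqrt_two_sq''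
  linear_combination (-4 * (3 - s) * P₁ * ϖ ^ 8 * (3 * r ^ 2 + 9 * r + 8)) * hr2

/-- The two constants as fourth powers: **`(3(√3 − 1)℘(1/3)/ϖ₀²)⁴ = 108 = 2²·3³`** and
**`((3 − √3)℘(1/3)/ϖ₀²)⁴ = 12 = 2²·3`** — i.e. `3(√3−1)℘(1/3)/ϖ₀² = √2·3^{3/4}` and
`(3−√3)℘(1/3)/ϖ₀² = √2·3^{1/4}` (both are positive reals): the `3`-adic orders of the constants
of `quarticSum_eq` / `quarticConjSum_eq`, measured against `ϖ₀·℘'`, are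
exactly `3/4` and `1/4` (and `1/2` for the `κ`-sum's `8√3`). Only `℘(1/3)² = (3+2√3)ϖ₀⁴/3`
enters. [folklore] -/
theorem quarticSum_constants_pow_four :
    (3 * ((Real.sqrt 3 : ℂ) - 1) * ℘[ofUpperHalfPlane UpperHalfPlane.I] (1 / 3) / ((Real.Gamma (1 / 4) ^ 2 / (2 * Real.sqrt (2 * π)) : ℝ) : ℂ) ^ 2) ^ 4 = 108 ∧
      ((3 - (Real.sqrt 3 : ℂ)) * ℘[ofUpperHalfPlane UpperHalfPlane.I] (1 / 3) / ((Real.Gamma (1 / 4) ^ 2 / (2 * Real.sqrt (2 * π)) : ℝ) : ℂ) ^ 2) ^ 4 = 12 := by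
  set s : ℂ := (Real.sqrt 3 : ℂ) with hs
  set ϖ : ℂ := ((Real.Gamma (1 / 4) ^ 2 / (2 * Real.sqrt (2 * π)) : ℝ) : ℂ) with hϖ
  set P₁ := ℘[ofUpperHalfPlane UpperHalfPlane.I] (1 / 3) with hP₁
  have hs2 : s ^ 2 = 3 := sqrt_three_sq''
  have hϖ0 : ϖ ≠ 0 := varpi_ne_zero'
  have hϖ8 : (ϖ ^ 2) ^ 4 ≠ 0 := pow_ne_zero _ (pow_ne_zero _ hϖ0)
  have h1 : P₁ ^ 2 = (3 + 2 * s) / 3 * ϖ ^ 4 := by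
    rw [hP₁, weierstrassP_third_sq, hs, hϖ]; push_cast; ring
  have h14 : P₁ ^ 4 = ((3 + 2 * s) / 3 * ϖ ^ 4) ^ 2 := by rw [← h1]; ring
  constructor
  · rw [div_pow, div_eq_iff hϖ8]
    linear_combination (81 * (s - 1) ^ 4) * h14 +
      (ϖ ^ 8 * (36 * s ^ 4 - 36 * s ^ 3 - 27 * s ^ 2 + 72 * s + 9)) * hs2
  · rw [div_pow, div_eq_iff hϖ8]
    linear_combination ((3 - s) ^ 4) * h14 +
      (ϖ ^ 8 / 9 * (4 * s ^ 4 - 36 * s ^ 3 + 93 * s ^ 2 - 207)) * hs2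

end Summit.BirchSwinnertonDyer.BirchSwinnertonDyer.Theorems.InertBadSignedBranchesInertBadAtThreeQuarticTorsionSums
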